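import Summits.QuantumFields.YangMills.Theorems.AlphaInputsT3ACFacts
import HarnessLib

/-!
# `AlphaInputsT3AC` — THE BRIDGE, PART 2: the package's data ASSEMBLED into the Literature interface's signature
# `T3AlphaInputsAC.AlphaDataT3 F γ` (`dataT3`, the recipe's `D_of`), and every interface schema the AC construction delivers
# PROVED for it: `Ineq41AE`, `Ineq47AE` (all `j ≤ K`), `ChiRange`, `MainTermIsAction`, `LFShape`, `TrivRegions`, `AdmOnSmall`,
# `RmSize` (closed form, physical-volume extensive), the `EcstBook` identity `Ecst K j = −Σ_{i<j} E^{(i)}`, integrability of `up_j`/`low_j`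
# for `j < K`, and `0 ≤ up`, `0 ≤ low` (pointwise)

Lane `pub-balaban3d`, seat alpha-1 (LINE 2 of `defn-AlphaInputsT3AC`, route `UnitScaleTilt`; recipe `pub/pub-balaban3d/LINE2-BRIDGE-RECIPE-
alpha1.md`, evidence on stmt-QuantumFields-18916).  Under the Summit-side socket `AlphaInputsT3AC.Of F 𝔠` (this directory) the package's
∃-bound data at `(γ, K)` are the record `AlphaInputsT3AC.PkgAt` (Bridge, part 1), with AC tower `p.T = towerOfAC 𝔠.lane p.X p.𝔖`.  THIS FILE
reads those objects, run by run, into the interface's field list: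

| `AlphaDataT3` field | value at run `K` (`p := h.pkgAt γ hγ hγ1 K`) |
|---|---|
| `Hist K j`, `triv K j` | `Carriers.Hist (F.P K) j`, `Hist.triv` (the tower's own, `TowerFactsAC.triv_towerOfAC_eq`) |
| `Ω K j h i` | `Carriers.Omega M₁ Rcol j h i` at the tower input's `M₁`, `Rcol` (the regions its `plaqsIn`/`Zvol` read) |
| `Adm K j h W` | `m_j(h, W) ≠ 0` — the support of the uncapped Radon–Nikodym masses (`TowerAC.HistWeightsAC`) |
| `LF`, `mainT`, `Pint`, `Zterm`, `χ`, `Estep`, `Rm` | the tower's `p.T.LF j`, `p.T.mainT j`, … |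
| `Umin K j h W` | the package's composite minimiser `p.UkH j h W` |
| `Ecst K j` | `p.T.Ecst j − p.E` (route normalisation: `resDensity` starts from `e^{−β_K A}`, the tower from `e^{−E}e^{−β_K A}`) |
| `Loc`, `Pterm`, `enl`, `treeLen` | a PARAMETER `π : AlphaInputsT3AC.PolymerT3 F` — see below |

WHAT IS PROVED (for `D := h.dataT3 γ hγ hγ1 π`, every `π`): `dataT3_ineq41AE`/`dataT3_ineq47AE` (`PkgAt.resDensity_le_ae`/`le_resDensity_ae`,
i.e. Theorem 2 for the AC tower + RN homogeneity), `dataT3_chiRange`, `dataT3_mainTermIsAction` (`PkgAt.mainT_eq`), `dataT3_lfShape`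
(`lf_towerOfAC_mono_of_support`/`_shift`), `dataT3_trivRegions` (`Carriers.Omega_triv`), `dataT3_admOnSmall` (the trivial history's mass is
`≥ 1`: `MassesAC.one_le_massRecAC_triv`), `dataT3_Ecst_eq` (`EcstBook` clause (i), `PkgAt.Ecst_sub_E_eq`), `dataT3_up_nonneg`; §3 `dataT3_rmSize`:
`RmSize D (r⋆γ^{3+κ₀}) (L^{−κ₀})` from the CLOSED FORM `PkgAt.Rm_eq` — `Rm^{(K)}_j = r⋆γ^{3+κ₀}·(Σ_{i<j} L^{−κ₀(K−i)})·(2L^m)³`, the booked profile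
`rcoef = r⋆(g²)^{3+κ₀}` times the unit `(Lⁱε_K)^{3+κ₀}|T₁^{(i)}| = L^{−κ₀(K−i)}(2L^m)³` (`rem_unit_T3Scales`) — hence contract B6 `dataT3_exp_two_Rm_le`;
§4 `dataT3_integrable_up`/`_low` for `j < K` from the step-`j` (α) rows `hU`/`hPm`/`hPb` (no such row exists at the top level `j = K`).

WHAT IS NOT PROVED, AND WHY (memo LINE2-INTERFACE-MEMO items 4–7; each is an (α) row the lane's `RunAlphaAC` does not carry in the
interface's form, or a Thm-1-side assembly over `AvgAC` not done): the polymer clauses `PintDecomp`/`IsLocal`/`GaugeInv26`/`TermSize`/`LocCover`/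
`EnlBounded` — they concern ONLY the parameter `π` against the tower's `Pint`/`Umin` (the lane's `Pint = pintOfSeries` IS a finite sum of
localised `StepSeries` activities, but their re-indexing into `Loc/Pterm` and the per-term (26)/locality are not lane rows); the minimiser rows
`Constraint42Top`/`Regularity68`/`UminTrivIsRegMinimiser`; the sizes `PintSize` ((46), the Thm-1 row `bound46` over `AvgAC`) and `EcstBook` (ii)
(`|E^{(i)}| ≤ C|T₁^{(i)}|` with `C` uniform in `K`: the lane's step constants are affine in `|log g_i|`, cf. card `ecst-gaussian-mass-obstruction`);
`RepAtHeights` (needs the identification `A(U_k V) = minActionRegPr V`); `EnvelopeRegular` at `j = K` and its positivity clause `0 < ∫ low_j`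
(positivity of the Haar measure of the small window).  DESIGN NOTE for the interface pen (recorded, not acted on): with `Adm :=`
mass support (the only choice compatible with `LFShape` for `LFAC`) and the lane's trivial mass floored at `1`, `Adm K j triv W` holds for EVERY
datum `W`, so `AdmOnSmall` is free but the `Adm`-conditioned minimiser rows at the trivial history quantify over all data.  CONDITIONAL on the
package; nothing of [Balaban1985UV3] is asserted.

References: T. Bałaban, Commun. Math. Phys. 102 (1985) 255–275 [Balaban1985UV3], (38)–(43) p.266, (47) p.267, (62)–(64) pp.271–273, Thm 2 p.272.
-/

set_option autoImplicit false

noncomputable section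

namespace Summit.QuantumFields.YangMills.Theorems

open MeasureTheory
open Literature.MathematicalPhysics.QuantumFieldTheory.Balaban1983to89
open Literature.MathematicalPhysics.QuantumFieldTheory.Balaban1983to89.T3ContinuumYM3Torus
open Literature.MathematicalPhysics.QuantumFieldTheory.Balaban1983to89.T3UnitLawDensityEML (ℰp)
open Literature.MathematicalPhysics.QuantumFieldTheory.Balaban1983to89.T3RestrictedUnitDensity (towerDensity resDensity)
open Literature.MathematicalPhysics.QuantumFieldTheory.Balaban1983to89.T3AlphaInputsAC
open Literature.MathematicalPhysics.QuantumFieldTheory.Balaban1985CMP102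
open Literature.MathematicalPhysics.QuantumFieldTheory.Balaban1985CMP102.Setting
open Summit.QuantumFields.Balaban3D.Carriers
open Summit.QuantumFields.Balaban3D.Proofs.Primitives
open Summit.QuantumFields.Balaban3D.Proofs.ScalesArithmetic (volT_eq card_site_eq)
open Summit.QuantumFields.Balaban3D.Proofs.Inputs (rcoefOf_carrier)
open Summit.QuantumFields.Balaban3D.Proofs.TowerAC
open Summit.QuantumFields.Balaban3D.Proofs.StandardAC
open Summit.QuantumFields.Balaban3D.Proofs.InputsAC
open Summit.QuantumFields.Balaban3D.Proofs.TowerFactsAC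
open Summit.QuantumFields.Balaban3D.Proofs.TransportAC (integrable_mul_exp_of_le)
open Summit.QuantumFields.Balaban3D.Proofs (Bound55Std.measurable_actionEta Bound55Std.actionEta_nonneg)

/-! ## §1 The polymer fields (a parameter) and the assembled datum -/

/-- **THE POLYMER FIELDS OF THE INTERFACE, AS A PARAMETER**: localisation domains `Loc`, individual interaction terms `Pterm = 𝒫_i(Y, U)`,
enlargement `enl = X ↦ X̃` and linear size `treeLen = 𝓛(Y)` in the interface's run-`K` currency ([Balaban1985UV3] (24)–(25) p.262, p.263,
(43) p.266).  The AC tower carries the interaction SUM `Pint` (43) but not this indexing of its terms; the assembled datum takes them as given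
(the clauses `PintDecomp`/`IsLocal`/`GaugeInv26`/`TermSize`/`LocCover`/`EnlBounded` are then conditions on this parameter alone).
[cite: Balaban1985UV3, (24)-(25) p.262 and (43) p.266] -/
structure AlphaInputsT3AC.PolymerT3 (F : T3Family) where
  /-- the localisation domains `Y_i` of level `i` summed in (43) for the history `h` -/
  Loc : (K j : ℕ) → Hist (F.P K) j → ℕ → Finset (Set (Site (F.P K) 0))
  /-- the individual interaction terms `𝒫_i(Y, U)` -/
  Pterm : (K i : ℕ) → Set (Site (F.P K) 0) → GaugeField (F.P K) 0 (Matrix.specialUnitaryGroup (Fin 2) ℂ) → ℝ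
  /-- the enlargement `X ↦ X̃` -/
  enl : (K i : ℕ) → Set (Site (F.P K) 0) → Set (Site (F.P K) 0)
  /-- the linear size `𝓛(Y)` -/
  treeLen : (K i : ℕ) → Set (Site (F.P K) 0) → ℝ

variable {F : T3Family} {𝔠 : AlphaConsts F.L (suGroupModel 2).N}

/-- **THE PACKAGE'S DATA ASSEMBLED INTO THE INTERFACE'S SIGNATURE** (the recipe's `D_of`): under `AlphaInputsT3AC.Of F 𝔠`, at coupling
`γ ∈ (0, (min γ₀ 1)²]`, the `AlphaDataT3 F γ` whose run-`K` fields are the objects of the AC tower of the package's chosen data `h.pkgAt γ hγ hγ1 K`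
(table in the module docstring) and whose polymer fields are the parameter `π`.  A DEFINITION (data assembled by classical choice from an
∃-package); nothing is asserted. [cite: Balaban1985UV3, (38)-(43) p.266 and (47) p.267] -/
def AlphaInputsT3AC.Of.dataT3 (h : AlphaInputsT3AC.Of F 𝔠) (γ : ℝ) (hγ : 0 < γ) (hγ1 : γ ≤ (min 𝔠.gamma0 1) ^ 2)
    (π : AlphaInputsT3AC.PolymerT3 F) : AlphaDataT3 F γ where
  Hist := fun K j => Hist (F.P K) j
  triv := fun K j => Hist.triv (F.P K) j
  Ω := fun K j hh i =>
    Omega (inputOfAC 𝔠.lane (h.pkgAt γ hγ hγ1 K).X (h.pkgAt γ hγ hγ1 K).𝔖).M₁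
      (inputOfAC 𝔠.lane (h.pkgAt γ hγ hγ1 K).X (h.pkgAt γ hγ hγ1 K).𝔖).Rcol j hh i
  Adm := fun K j hh W => (inputOfAC 𝔠.lane (h.pkgAt γ hγ hγ1 K).X (h.pkgAt γ hγ hγ1 K).𝔖).W.mass j hh W ≠ 0
  LF := fun K j W Φ => (h.pkgAt γ hγ hγ1 K).T.LF j W Φ
  Umin := fun K j hh W => (h.pkgAt γ hγ hγ1 K).UkH j hh W
  mainT := fun K j hh W => (h.pkgAt γ hγ hγ1 K).T.mainT j hh W
  Pint := fun K j hh W => (h.pkgAt γ hγ hγ1 K).T.Pint j hh W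
  Loc := π.Loc
  Pterm := π.Pterm
  enl := π.enl
  treeLen := π.treeLen
  Zterm := fun K j hh => (h.pkgAt γ hγ hγ1 K).T.Zterm j hh
  χ := fun K j W => (h.pkgAt γ hγ hγ1 K).T.χ j W
  Estep := fun K i => (h.pkgAt γ hγ hγ1 K).T.Estep i
  Ecst := fun K j => (h.pkgAt γ hγ hγ1 K).T.Ecst j - (h.pkgAt γ hγ hγ1 K).E
  Rm := fun K j => (h.pkgAt γ hγ hγ1 K).T.Rm j

/-! ## §2 The schemas delivered -/

section Delivered

variable (h : AlphaInputsT3AC.Of F 𝔠) (γ : ℝ) (hγ : 0 < γ) (hγ1 : γ ≤ (min 𝔠.gamma0 1) ^ 2) (π : AlphaInputsT3AC.PolymerT3 F)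

/-- The assembled majorant `up` IS the tower's (41)-functional at the printed exponent (definitional). [cite: Balaban1985UV3, (41) p.266] -/
theorem AlphaInputsT3AC.Of.dataT3_up_eq (K j : ℕ) (W : GaugeField (F.P K) j (Matrix.specialUnitaryGroup (Fin 2) ℂ)) :
    (h.dataT3 γ hγ hγ1 π).up K j W =
      (h.pkgAt γ hγ hγ1 K).T.LF j W fun hh =>
        -((h.pkgAt γ hγ hγ1 K).T.mainT j hh W) + (h.pkgAt γ hγ hγ1 K).T.Pint j hh W + (h.pkgAt γ hγ hγ1 K).T.Zterm j hh := rfl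

/-- The assembled minorant `low` IS the tower's (47)-term (definitional). [cite: Balaban1985UV3, (47) p.267] -/
theorem AlphaInputsT3AC.Of.dataT3_low_eq (K j : ℕ) (W : GaugeField (F.P K) j (Matrix.specialUnitaryGroup (Fin 2) ℂ)) :
    (h.dataT3 γ hγ hγ1 π).low K j W =
      (h.pkgAt γ hγ hγ1 K).T.χ j W *
        Real.exp (-((h.pkgAt γ hγ hγ1 K).T.mainT j (Hist.triv (F.P K) j) W) +
          (h.pkgAt γ hγ hγ1 K).T.Pint j (Hist.triv (F.P K) j) W) := rfl

/-- **(41)′ `dV`-A.E. FOR THE ASSEMBLED DATUM, EVERY LEVEL `j ≤ K` OF EVERY RUN** — the interface's `Ineq41AE`: Theorem 2 for the AC tower of the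
package's data (`Thm2AC` through `PkgAt.ineq41_47`), transported to the route's `resDensity` by the `e^{E}`-renormalisation
(`PkgAt.resDensity_le_ae`). [cite: Balaban1985UV3, (41) p.266 and Thm 2 p.272] -/
theorem AlphaInputsT3AC.Of.dataT3_ineq41AE (K j : ℕ) (hj : j ≤ K) : Ineq41AE (h.dataT3 γ hγ hγ1 π) K j :=
  (h.pkgAt γ hγ hγ1 K).resDensity_le_ae j hj

/-- **(47)′ `dV`-A.E. FOR THE ASSEMBLED DATUM, EVERY LEVEL `j ≤ K` OF EVERY RUN** — the interface's `Ineq47AE` (`PkgAt.le_resDensity_ae`).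
[cite: Balaban1985UV3, (47) p.267 and Thm 2 p.272] -/
theorem AlphaInputsT3AC.Of.dataT3_ineq47AE (K j : ℕ) (hj : j ≤ K) : Ineq47AE (h.dataT3 γ hγ hγ1 π) K j :=
  (h.pkgAt γ hγ hγ1 K).le_resDensity_ae j hj

/-- The package's sandwich clause in the interface's bundled form: `∀ K j ≤ K, Ineq41AE ∧ Ineq47AE`. [cite: Balaban1985UV3, Thm 2 p.272] -/
theorem AlphaInputsT3AC.Of.dataT3_ineq41AE_47AE (K j : ℕ) (hj : j ≤ K) :
    Ineq41AE (h.dataT3 γ hγ hγ1 π) K j ∧ Ineq47AE (h.dataT3 γ hγ hγ1 π) K j :=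
  ⟨h.dataT3_ineq41AE γ hγ hγ1 π K j hj, h.dataT3_ineq47AE γ hγ hγ1 π K j hj⟩

/-- **`ChiRange` FOR THE ASSEMBLED DATUM**: the tower's characteristic function takes values in `[0, 1]`
(`TowerFactsAC.chi_towerOfAC_nonneg/_le_one`). [cite: Balaban1985UV3, (47) p.267] -/
theorem AlphaInputsT3AC.Of.dataT3_chiRange : ChiRange (h.dataT3 γ hγ hγ1 π) := fun K j W =>
  ⟨chi_towerOfAC_nonneg 𝔠.lane (h.pkgAt γ hγ hγ1 K).X (h.pkgAt γ hγ hγ1 K).𝔖 j W,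
    chi_towerOfAC_le_one 𝔠.lane (h.pkgAt γ hγ hγ1 K).X (h.pkgAt γ hγ hγ1 K).𝔖 j W⟩

/-- **`MainTermIsAction` FOR THE ASSEMBLED DATUM**: `mainT^{(K)}_j(h, W) = β_K · Σ_q[1 − Re tr U_j(h,W)(∂q)]` with `Umin := U_j(·,h)` — EXACT
(`AlphaInputsT3ACFacts.PkgAt.mainT_eq`: `(1/g_j²)η⁻¹ = 1/(g²ε) = β_K`). [cite: Balaban1985UV3, (5) p.256 and (41) p.266] -/
theorem AlphaInputsT3AC.Of.dataT3_mainTermIsAction : MainTermIsAction (h.dataT3 γ hγ hγ1 π) := fun K j hh W =>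
  (h.pkgAt γ hγ hγ1 K).mainT_eq j hh W

/-- **`LFShape` FOR THE ASSEMBLED DATUM**: `LF_j(W)[Φ] = Σ_h m_j(h,W)·e^{Φ(h)}` is monotone in `Φ` on the support `Adm = {m ≠ 0}` and
multiplicative on constants (`TowerFactsAC.lf_towerOfAC_mono_of_support`, `lf_towerOfAC_shift`). [cite: Balaban1985UV3, (41) p.266] -/
theorem AlphaInputsT3AC.Of.dataT3_lfShape : LFShape (h.dataT3 γ hγ hγ1 π) :=
  ⟨fun K j W Φ Ψ hle => lf_towerOfAC_mono_of_support 𝔠.lane (h.pkgAt γ hγ hγ1 K).X (h.pkgAt γ hγ hγ1 K).𝔖 j W Φ Ψ hle,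
    fun K j W Φ t => lf_towerOfAC_shift 𝔠.lane (h.pkgAt γ hγ hγ1 K).X (h.pkgAt γ hγ hγ1 K).𝔖 j W Φ t⟩

/-- **`TrivRegions` FOR THE ASSEMBLED DATUM**: every region of the trivial history is the whole torus (`Carriers.Omega_triv`).
[cite: Balaban1985UV3, (47) p.267 and p.272] -/
theorem AlphaInputsT3AC.Of.dataT3_trivRegions : TrivRegions (h.dataT3 γ hγ hγ1 π) := fun _ j i =>
  Omega_triv _ _ j i

/-- **THE TRIVIAL HISTORY IS ALWAYS ADMISSIBLE** for the assembled datum: its mass is `≥ 1` at every datum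
(`MassesAC.one_le_massRecAC_triv` through `StandardAC`), so `m_j(triv, W) ≠ 0`. [cite: Balaban1985UV3, (47) p.267] -/
theorem AlphaInputsT3AC.Of.dataT3_adm_triv (K j : ℕ) (W : GaugeField (F.P K) j (Matrix.specialUnitaryGroup (Fin 2) ℂ)) :
    (h.dataT3 γ hγ hγ1 π).Adm K j ((h.dataT3 γ hγ hγ1 π).triv K j) W := by
  show (inputOfAC 𝔠.lane (h.pkgAt γ hγ hγ1 K).X (h.pkgAt γ hγ hγ1 K).𝔖).W.mass j (Hist.triv (F.P K) j) W ≠ 0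
  have h1 := one_le_stdTowerInputAC_mass_triv (h.pkgAt γ hγ hγ1 K).X 𝔠.lane.carrier (h.pkgAt γ hγ hγ1 K).𝔖 j W
  exact ne_of_gt (lt_of_lt_of_le one_pos h1)

/-- **`AdmOnSmall` FOR THE ASSEMBLED DATUM** (for ANY `b₀, p₀`): the small window at the trivial history is admissible — because every
datum is (`dataT3_adm_triv`). [cite: Balaban1985UV3, (47) p.267] -/
theorem AlphaInputsT3AC.Of.dataT3_admOnSmall (b₀ p₀ : ℝ) : AdmOnSmall (h.dataT3 γ hγ hγ1 π) b₀ p₀ := fun K j W _ _ =>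
  h.dataT3_adm_triv γ hγ hγ1 π K j W

/-- **THE `EcstBook` IDENTITY FOR THE ASSEMBLED DATUM** (clause (i)): `Ecst K j = −Σ_{i<j} Estep K i` for `j ≤ K` — `E_j − E` with (64)
`E_j = Σ_{i=j}^{K−1} E^{(i)}` and `E = E_0` (`PkgAt.Ecst_sub_E_eq`). [cite: Balaban1985UV3, (62) p.271 and (64) p.273] -/
theorem AlphaInputsT3AC.Of.dataT3_Ecst_eq (K j : ℕ) (hj : j ≤ K) :
    (h.dataT3 γ hγ hγ1 π).Ecst K j = -∑ i ∈ Finset.range j, (h.dataT3 γ hγ hγ1 π).Estep K i :=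
  (h.pkgAt γ hγ hγ1 K).Ecst_sub_E_eq j hj

/-- `0 ≤ up` POINTWISE for the assembled datum (`LF = Σ_h m·exp ≥ 0`, masses non-negative). [cite: Balaban1985UV3, (41) p.266] -/
theorem AlphaInputsT3AC.Of.dataT3_up_nonneg (K j : ℕ) (W : GaugeField (F.P K) j (Matrix.specialUnitaryGroup (Fin 2) ℂ)) :
    0 ≤ (h.dataT3 γ hγ hγ1 π).up K j W :=
  lfAC_nonneg (inputOfAC 𝔠.lane (h.pkgAt γ hγ hγ1 K).X (h.pkgAt γ hγ hγ1 K).𝔖).W j W _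

/-- `0 ≤ low` pointwise for the assembled datum (`ChiRange`). [cite: Balaban1985UV3, (47) p.267] -/
theorem AlphaInputsT3AC.Of.dataT3_low_nonneg (K j : ℕ) (W : GaugeField (F.P K) j (Matrix.specialUnitaryGroup (Fin 2) ℂ)) :
    0 ≤ (h.dataT3 γ hγ hγ1 π).low K j W :=
  low_nonneg (h.dataT3_chiRange γ hγ hγ1 π) K j W

end Delivered

/-! ## §3 The printed size of the remainder, `RmSize`: `Rm^{(K)}_j = r⋆γ^{3+κ₀}·(2L^m)³·Σ_{i<j} q^{K−i}`, `q = L^{−κ₀}` -/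

section Remainder

variable (F : T3Family) (γ : ℝ) (hγ : 0 < γ) (hγ1 : γ ≤ 1) (K : ℕ)

/-- **THE REMAINDER UNIT AT THE T³ SCALES IS PHYSICAL-VOLUME EXTENSIVE**: for `i ≤ K`,
`(Lⁱε_K)^{3+κ₀}·|T₁^{(i)}| = q^{K−i}·(2L^m)³` with `q = L^{−κ₀}` — «(Lʲε)^{3+κ₀}|T₁^{(j)}|» of (41) p.266 with `|T₁^{(j)}| = (Lʲε)^{−3}|T_ε|`
((5) p.256), `ε_K = L^{−K}` and `|T_ε| = (2L^m)³` (the unit-lattice volume of the family). [cite: Balaban1985UV3, (5) p.256 and (41) p.266] -/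
theorem rem_unit_T3Scales (κ₀ : ℝ) (i : ℕ) (hi : i ≤ K) :
    ((F.L : ℝ) ^ i * (T3Scales F γ hγ hγ1 K).ε) ^ (3 + κ₀) * (T3Scales F γ hγ hγ1 K).sites i
      = (((F.L : ℝ)⁻¹) ^ κ₀) ^ (K - i) * (2 * (F.L : ℝ) ^ F.m) ^ 3 := by
  have hL : (0 : ℝ) < F.L := by exact_mod_cast (zero_lt_one.trans F.hL.2)
  have hLi : (0 : ℝ) ≤ (F.L : ℝ)⁻¹ := inv_nonneg.mpr hL.le
  have hε : (T3Scales F γ hγ hγ1 K).ε = ((F.L : ℝ)⁻¹) ^ K := rfl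
  have hx : (F.L : ℝ) ^ i * (T3Scales F γ hγ hγ1 K).ε = ((F.L : ℝ)⁻¹) ^ (K - i) := by
    rw [hε, inv_pow, inv_pow, show (F.L : ℝ) ^ K = (F.L : ℝ) ^ i * (F.L : ℝ) ^ (K - i) by
      rw [← pow_add, Nat.add_sub_cancel' hi], mul_inv, ← mul_assoc, mul_inv_cancel₀ (pow_ne_zero _ hL.ne'), one_mul]
  have hxpos : 0 < ((F.L : ℝ)⁻¹) ^ (K - i) := pow_pos (inv_pos.mpr hL) _
  have hsites : (T3Scales F γ hγ hγ1 K).sites i =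
      (((F.L : ℝ) ^ i * (T3Scales F γ hγ hγ1 K).ε)⁻¹) ^ 3 * (T3Scales F γ hγ hγ1 K).volT := rfl
  have hvol : (T3Scales F γ hγ hγ1 K).volT = (2 * (F.L : ℝ) ^ F.m) ^ 3 := by
    rw [volT_eq, card_site_eq _ 0, Nat.sub_zero, hε]
    show (2 * (F.L : ℝ) ^ (F.m + K)) ^ 3 * (((F.L : ℝ)⁻¹) ^ K) ^ 3 = _
    rw [← mul_pow, pow_add, inv_pow, mul_assoc, mul_inv_cancel_right₀ (pow_ne_zero _ hL.ne')]
  have h3 : (((F.L : ℝ)⁻¹) ^ (K - i)) ^ ((3 : ℝ) + κ₀) = (((F.L : ℝ)⁻¹) ^ (K - i)) ^ (3 : ℕ) * (((F.L : ℝ)⁻¹) ^ (K - i)) ^ κ₀ := by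
    rw [Real.rpow_add hxpos, ← Real.rpow_natCast _ 3]
    norm_num
  have hq : (((F.L : ℝ)⁻¹) ^ (K - i)) ^ κ₀ = (((F.L : ℝ)⁻¹) ^ κ₀) ^ (K - i) := by
    rw [← Real.rpow_natCast_mul hLi, mul_comm, Real.rpow_mul_natCast hLi]
  rw [hsites, hx, hvol, h3, hq]
  field_simp

variable {F γ hγ K} {𝔠 : AlphaConsts F.L (suGroupModel 2).N} {hγ1' : γ ≤ (min 𝔠.gamma0 1) ^ 2}

/-- **THE REMAINDER OF (41)/(47) IN THE PACKAGE'S TOWER, CLOSED FORM**: for `j ≤ K`,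
`Rm_j = r⋆·γ^{3+κ₀}·(Σ_{i<j} q^{K−i})·(2L^m)³`, `q = L^{−κ₀}`, `r⋆ = max C₁ C₁′ + C₂ + C₃ + C₄` — the booked profile `rcoef_i =
r⋆(g²)^{3+κ₀}` (`Inputs.rcoefOf_carrier`, `g² = γ`) times the unit `rem_unit_T3Scales`. [cite: Balaban1985UV3, (41) p.266] -/
theorem AlphaInputsT3AC.PkgAt.Rm_eq (p : AlphaInputsT3AC.PkgAt F 𝔠 γ hγ hγ1' K) (j : ℕ) (hj : j ≤ K) :
    p.T.Rm j = 𝔠.stepConsts.rstar * γ ^ (3 + 𝔠.κ₀) *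
      (∑ i ∈ Finset.range j, (((F.L : ℝ)⁻¹) ^ 𝔠.κ₀) ^ (K - i)) * (2 * (F.L : ℝ) ^ F.m) ^ 3 := by
  have hg2 : (T3Scales F γ hγ (hγ1'.trans (sq_min_one_le _ 𝔠.gamma0_pos)) K).g ^ 2 = γ := Real.sq_sqrt hγ.le
  show ∑ i ∈ Finset.range j, rcoefOf _ 𝔠.lane.carrier i *
      ((F.L : ℝ) ^ i * (T3Scales F γ hγ (hγ1'.trans (sq_min_one_le _ 𝔠.gamma0_pos)) K).ε) ^ (3 + 𝔠.κ₀) *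
        (T3Scales F γ hγ (hγ1'.trans (sq_min_one_le _ 𝔠.gamma0_pos)) K).sites i = _
  rw [Finset.mul_sum, Finset.sum_mul]
  refine Finset.sum_congr rfl fun i hi => ?_
  have hiK : i ≤ K := (Finset.mem_range.mp hi).le.trans hj
  rw [rcoefOf_carrier, hg2, mul_assoc,
    rem_unit_T3Scales F γ hγ (hγ1'.trans (sq_min_one_le _ 𝔠.gamma0_pos)) K 𝔠.κ₀ i hiK]
  show 𝔠.stepConsts.rstar * γ ^ (3 + 𝔠.κ₀) * ((((F.L : ℝ)⁻¹) ^ 𝔠.κ₀) ^ (K - i) * (2 * (F.L : ℝ) ^ F.m) ^ 3) = _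
  ring

end Remainder

section RemainderSize

variable (h : AlphaInputsT3AC.Of F 𝔠) (γ : ℝ) (hγ : 0 < γ) (hγ1 : γ ≤ (min 𝔠.gamma0 1) ^ 2) (π : AlphaInputsT3AC.PolymerT3 F)

/-- **`RmSize` FOR THE ASSEMBLED DATUM** — the interface's printed size of the remainder, with the constants `C = r⋆γ^{3+κ₀}` and
`q = L^{−κ₀} ∈ [0, 1)` (`κ₀ > 0`, `L > 1`): `0 ≤ Rm^{(K)}_j ≤ C·Σ_{i<j} q^{K−i}·(2L^m)³` for `j ≤ K` (with EQUALITY, `PkgAt.Rm_eq`) — (41) p.266 last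
term «Σ_{j<k} O((Lʲε)^{3+κ₀})|T₁^{(j)}|», extensive in the PHYSICAL volume only, uniform in the cut-off. [cite: Balaban1985UV3, (41) p.266 and (5) p.256] -/
theorem AlphaInputsT3AC.Of.dataT3_rmSize :
    RmSize (h.dataT3 γ hγ hγ1 π) (𝔠.stepConsts.rstar * γ ^ (3 + 𝔠.κ₀)) (((F.L : ℝ)⁻¹) ^ 𝔠.κ₀) := by
  have hL1 : (1 : ℝ) < F.L := by exact_mod_cast F.hL.2
  have hL : (0 : ℝ) < F.L := zero_lt_one.trans hL1
  have hLi : (0 : ℝ) ≤ (F.L : ℝ)⁻¹ := inv_nonneg.mpr hL.le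
  have hq0 : 0 ≤ ((F.L : ℝ)⁻¹) ^ 𝔠.κ₀ := Real.rpow_nonneg hLi _
  refine ⟨hq0, Real.rpow_lt_one hLi (inv_lt_one_of_one_lt₀ hL1) 𝔠.κ₀_pos, fun K j hj => ?_⟩
  have heq : (h.dataT3 γ hγ hγ1 π).Rm K j = 𝔠.stepConsts.rstar * γ ^ (3 + 𝔠.κ₀) *
      (∑ i ∈ Finset.range j, (((F.L : ℝ)⁻¹) ^ 𝔠.κ₀) ^ (K - i)) * (2 * (F.L : ℝ) ^ F.m) ^ 3 :=
    (h.pkgAt γ hγ hγ1 K).Rm_eq j hj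
  refine ⟨?_, heq.le⟩
  rw [heq]
  have h1 : 0 ≤ 𝔠.stepConsts.rstar := 𝔠.stepConsts.rstar_nonneg
  have h2 : 0 ≤ γ ^ (3 + 𝔠.κ₀) := Real.rpow_nonneg hγ.le _
  have h3 : 0 ≤ ∑ i ∈ Finset.range j, (((F.L : ℝ)⁻¹) ^ 𝔠.κ₀) ^ (K - i) := Finset.sum_nonneg fun i _ => pow_nonneg hq0 _
  have h4 : 0 ≤ (2 * (F.L : ℝ) ^ F.m) ^ 3 := by positivity
  exact mul_nonneg (mul_nonneg (mul_nonneg h1 h2) h3) h4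

/-- Hence contract B6 for the assembled datum: `e^{2Rm_j} ≤ C_Rm` uniformly in `K` and `j ≤ K` (`T3AlphaInputsAC.exp_two_Rm_le`).
[cite: Balaban1985UV3, (41) p.266] -/
theorem AlphaInputsT3AC.Of.dataT3_exp_two_Rm_le :
    ∃ CRm : ℝ, ∀ K j, j ≤ K → Real.exp (2 * (h.dataT3 γ hγ hγ1 π).Rm K j) ≤ CRm :=
  exp_two_Rm_le (h.dataT3_rmSize γ hγ hγ1 π)

end RemainderSize

/-! ## §4 Integrability of the envelopes below the top level (`EnvelopeRegular`, clauses 1–2, for `j < K`) -/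

section Envelopes

variable (h : AlphaInputsT3AC.Of F 𝔠) (γ : ℝ) (hγ : 0 < γ) (hγ1 : γ ≤ (min 𝔠.gamma0 1) ^ 2) (π : AlphaInputsT3AC.PolymerT3 F)

/-- **`up_j` IS INTEGRABLE FOR `j < K`**: `up_j(W) = Σ_h m_j(h,W)·exp(−mainT_j(h,W) + Pint_j(h,W) + Zterm_j(h))` with INTEGRABLE masses
(`StandardAC.stdTowerInputAC_mass_integrable`), `mainT ≥ 0` measurable through the (α) row `hU` (measurable composite minimiser), and `Pint`
measurable and bounded above by the (α) rows `hPm`/`hPb` of step `j` (`AlphaAC.StepAlphaAC`, available for `j + 1 ≤ K` only — the package carries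
no step row at the top level). [cite: Balaban1985UV3, (41) p.266] -/
theorem AlphaInputsT3AC.Of.dataT3_integrable_up (K j : ℕ) (hj : j + 1 ≤ K) :
    Integrable ((h.dataT3 γ hγ hγ1 π).up K j) (fieldMeasure (F.P K) j (Matrix.specialUnitaryGroup (Fin 2) ℂ)) := by
  have st := (h.pkgAt γ hγ hγ1 K).run.steps j hj
  show Integrable (fun W => ∑ hh : Hist (F.P K) j,
    (inputOfAC 𝔠.lane (h.pkgAt γ hγ hγ1 K).X (h.pkgAt γ hγ hγ1 K).𝔖).W.mass j hh W *
      Real.exp (-((h.pkgAt γ hγ hγ1 K).T.mainT j hh W) + (h.pkgAt γ hγ hγ1 K).T.Pint j hh W + (h.pkgAt γ hγ hγ1 K).T.Zterm j hh)) _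
  refine integrable_finsetSum _ fun hh _ => ?_
  have hmain : ∀ W : GaugeField (F.P K) j (Matrix.specialUnitaryGroup (Fin 2) ℂ), (h.pkgAt γ hγ hγ1 K).T.mainT j hh W =
      ((T3Scales F γ hγ (hγ1.trans (sq_min_one_le _ 𝔠.gamma0_pos)) K).gk j)⁻¹ ^ 2 *
        (T3Scales F γ hγ (hγ1.trans (sq_min_one_le _ 𝔠.gamma0_pos)) K).actionEta j ((h.pkgAt γ hγ hγ1 K).UkH j hh W) :=
    fun _ => rfl
  refine integrable_mul_exp_of_le
    (stdTowerInputAC_mass_integrable (h.pkgAt γ hγ hγ1 K).X 𝔠.lane.carrier (h.pkgAt γ hγ hγ1 K).𝔖 j hh) ?_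
    (c := (h.pkgAt γ hγ hγ1 K).𝔄.cP j + (h.pkgAt γ hγ hγ1 K).T.Zterm j hh) ?_
  · simp_rw [hmain]
    exact ((measurable_const.mul ((Bound55Std.measurable_actionEta
      (S := T3Scales F γ hγ (hγ1.trans (sq_min_one_le _ 𝔠.gamma0_pos)) K) j).comp (st.hU hh))).neg.add (st.hPm hh)).add
      measurable_const
  · intro W
    have h0 : 0 ≤ (h.pkgAt γ hγ hγ1 K).T.mainT j hh W := by
      rw [hmain]
      exact mul_nonneg (sq_nonneg _) (Bound55Std.actionEta_nonneg
        (S := T3Scales F γ hγ (hγ1.trans (sq_min_one_le _ 𝔠.gamma0_pos)) K) j _)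
    have h1 : (h.pkgAt γ hγ hγ1 K).T.Pint j hh W ≤ (h.pkgAt γ hγ hγ1 K).𝔄.cP j := st.hPb hh W
    linarith

/-- **`low_j` IS INTEGRABLE FOR `j < K`**: `low_j = χ_j·exp(−mainT_j(triv,·) + Pint_j(triv,·))` with `χ_j ∈ {0,1}` measurable (`chiSmall`), the
exponent measurable and bounded above by the step-`j` (α) rows `hU`/`hPm`/`hPb` (`Transport48.integrable_weight_mul_exp`). [cite: Balaban1985UV3, (47) p.267] -/
theorem AlphaInputsT3AC.Of.dataT3_integrable_low (K j : ℕ) (hj : j + 1 ≤ K) :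
    Integrable ((h.dataT3 γ hγ hγ1 π).low K j) (fieldMeasure (F.P K) j (Matrix.specialUnitaryGroup (Fin 2) ℂ)) := by
  have st := (h.pkgAt γ hγ hγ1 K).run.steps j hj
  have hchi : (h.dataT3 γ hγ hγ1 π).χ K j =
      chiSmall Set.univ ((inputOfAC 𝔠.lane (h.pkgAt γ hγ hγ1 K).X (h.pkgAt γ hγ hγ1 K).𝔖).ε₁ j) := rfl
  have hmain : ∀ W : GaugeField (F.P K) j (Matrix.specialUnitaryGroup (Fin 2) ℂ),
      (h.pkgAt γ hγ hγ1 K).T.mainT j (Hist.triv (F.P K) j) W =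
      ((T3Scales F γ hγ (hγ1.trans (sq_min_one_le _ 𝔠.gamma0_pos)) K).gk j)⁻¹ ^ 2 *
        (T3Scales F γ hγ (hγ1.trans (sq_min_one_le _ 𝔠.gamma0_pos)) K).actionEta j
          ((h.pkgAt γ hγ hγ1 K).UkH j (Hist.triv (F.P K) j) W) :=
    fun _ => rfl
  show Integrable (fun W => (h.dataT3 γ hγ hγ1 π).χ K j W *
    Real.exp (-((h.pkgAt γ hγ hγ1 K).T.mainT j (Hist.triv (F.P K) j) W) +
      (h.pkgAt γ hγ hγ1 K).T.Pint j (Hist.triv (F.P K) j) W)) _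
  refine Balaban3D.Proofs.Transport48.integrable_weight_mul_exp ?_ ?_ ?_ ?_ (c := (h.pkgAt γ hγ hγ1 K).𝔄.cP j) ?_
  · rw [hchi]; exact T4AxialGaugeFixing.measurable_chiSmall _ _
  · intro W; rw [hchi]; unfold chiSmall; split_ifs <;> norm_num
  · intro W; rw [hchi]; unfold chiSmall; split_ifs <;> norm_num
  · simp_rw [hmain]
    exact (measurable_const.mul ((Bound55Std.measurable_actionEta
      (S := T3Scales F γ hγ (hγ1.trans (sq_min_one_le _ 𝔠.gamma0_pos)) K) j).comp (st.hU _))).neg.add (st.hPm _)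
  · intro W
    have h0 : 0 ≤ (h.pkgAt γ hγ hγ1 K).T.mainT j (Hist.triv (F.P K) j) W := by
      rw [hmain]
      exact mul_nonneg (sq_nonneg _) (Bound55Std.actionEta_nonneg
        (S := T3Scales F γ hγ (hγ1.trans (sq_min_one_le _ 𝔠.gamma0_pos)) K) j _)
    have h1 : (h.pkgAt γ hγ hγ1 K).T.Pint j (Hist.triv (F.P K) j) W ≤ (h.pkgAt γ hγ hγ1 K).𝔄.cP j := st.hPb _ W
    linarith

/-- Hence `up_j` is integrable on every event (contract B4) for `j < K`. [cite: Balaban1985UV3, (41) p.266] -/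
theorem AlphaInputsT3AC.Of.dataT3_integrableOn_up (K j : ℕ) (hj : j + 1 ≤ K)
    (E : Set (GaugeField (F.P K) j (Matrix.specialUnitaryGroup (Fin 2) ℂ))) :
    IntegrableOn ((h.dataT3 γ hγ hγ1 π).up K j) E (fieldMeasure (F.P K) j (Matrix.specialUnitaryGroup (Fin 2) ℂ)) :=
  (h.dataT3_integrable_up γ hγ hγ1 π K j hj).integrableOn

end Envelopes

end Summit.QuantumFields.YangMills.Theorems

end
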